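import Mathlib
import Summits.ValiantsHypothesis.ValiantsHypothesis.Theorems.NewtonTauWeak.Negative.Zonogon
import Summits.ValiantsHypothesis.ValiantsHypothesis.Theorems.NewtonUnitEquationsNewtonTauWeakSignLevelSetOfT2
import Summits.ValiantsHypothesis.ValiantsHypothesis.Theorems.NewtonUnitEquationsNewtonTauWeakSignLevelSetOfT2All
import Summits.ValiantsHypothesis.ValiantsHypothesis.Theorems.NewtonUnitEquationsNewtonTauWeakPenalisedFace
import Summits.ValiantsHypothesis.ValiantsHypothesis.Theorems.NewtonUnitEquationsNewtonTauWeakOddCoverWeight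

/-!
# `NewtonUnitEquationsNewtonTauWeakExactCoverShadow` — the sign-design kill switch: T2 controls every `𝔽₂^r` level set and every
# exact-cover shadow (set partitions, perfect matchings, axial assignments)

Line `binomial-normal-form` of crux `NewtonTauWeak` (stmt-ValiantsHypothesis-5904), lead c7, wave B composition (rung `RungC7b` of
`Cruxes/NewtonTauWeak/Lines/binomial_normal_form.lean`; registered stubs landed: `stub_signLevelSetOfT2` p139188,
`stub_signLevelSetOfT2All` p139339, `stub_penalisedFace` p139459, `stub_oddCoverWeight` p139377).

`T2(b)` is the open registered stub `stub_binomialNewtonTauCommon` with a FIXED exponent `b`: every sum of `K` scalar multiples of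
products of `N` binomials `1 − ρ_{lj} X^{d_j}` over a common exponent list has `≤ (K N + 2)^b` Newton vertices (KPTT Conj. 1 at
`t = 2`, polynomial form).

* `signLevelSet_of_T2` — **kill switch over `𝔽₂^r`.**  `T2(b) ⇒` for all `r, N`, labels `g : Fin N → (Fin r → ZMod 2)`, targets `v`
  and exponent lists `d` (coincidences allowed): `#ext conv {Σ_{j∈J} d_j : Σ_{j∈J} g_j = v} ≤ (2^r·N + 2)^b`.  The `K = 2^r`
  sign-twisted products `Π_j (1 − χ_l(g_j) ρ_j X^{d_j})` (`χ_l(x) = (−1)^{⟨l,x⟩}`, the characters of `𝔽₂^r`) isolate the level set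
  (P1), and dissociation is free (P2).
* `exactCoverShadow_of_T2` — **exact-cover faces.**  `T2(b) ⇒` for every labelled family and every `ε : Fin N → ℕ²`, the points
  `Σ_{j∈J} ε_j` of the EXACT COVERS `J` (every coordinate `i < r` covered by exactly one `j ∈ J`) that strictly minimise some
  `w₀x₀ + w₁x₁` with `w₀, w₁ > 0` number at most `(2^r·N + 2)^b`: odd covers of the all-ones target weigh `≥ r` with equality
  exactly for exact covers (P4), and the minimum-weight face survives the dominant penalty `C·weight·(1,1)` added to the items (P3),
  which turns it into a sign level set.  Instances: items = all nonempty subsets of `[r]` — SET PARTITIONS (parametric set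
  partitioning; soft-decision decoding of the Hamming coset); items = pairs — PERFECT MATCHINGS (biobjective matching:
  `σ(DS_n) ≤ 2^{O(n)}` is Hrubeš–Yehudayoff 2021 Prop. 23, consistent); items = transversal triples — AXIAL 3-ASSIGNMENTS.

A family of exact-cover clouds with more than `(2^r N + 2)^b` strictly positively exposed points for every `b` is therefore a
formal refutation of the stub (and of KPTT's Conjecture 1 in print, already at `t = 2`); the weak crux `NewtonTauWeak` is not
touched (`2^{am}` absorbs every `t = 2` instance).  Folklore throughout; no named facts, no citations, no `def`s.
-/

-- Sub = Summit single-conjunct layout: the duplicated namespace component is mandated by the tree.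
set_option linter.dupNamespace false

noncomputable section

open scoped BigOperators
open MvPolynomial
open Summit.ValiantsHypothesis.ValiantsHypothesis.Theorems.NewtonTauWeak.Negative (vert)

namespace Summit.ValiantsHypothesis.ValiantsHypothesis.Theorems.NewtonUnitEquationsNewtonTauWeak

/-- **T2 ⇒ polynomial hull counts for ALL `𝔽₂^r` level sets (sign-design kill switch).**  If the open stub holds with exponent
`b`, then for every `r`, `N`, labels `g : Fin N → (Fin r → ZMod 2)`, target `v` and exponent list `d` (coincidences allowed),
`#ext conv {Σ_{j∈J} d_j : Σ_{j∈J} g_j = v} ≤ (2^r·N + 2)^b`: `stub_signLevelSetOfT2All` fed with `stub_signLevelSetOfT2`. [folklore] -/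
theorem signLevelSet_of_T2 (b : ℕ)
    (hT2 : ∀ (K N : ℕ) (c : Fin K → ℂ) (ρ : Fin K → Fin N → ℂ) (d : Fin N → (Fin 2 →₀ ℕ)),
      vert (∑ l, C (c l) * ∏ j, (1 - C (ρ l j) * monomial (d j) 1)) ≤ (K * N + 2) ^ b)
    (N r : ℕ) (g : Fin N → Fin r → ZMod 2) (v : Fin r → ZMod 2) (d : Fin N → (Fin 2 →₀ ℕ)) :
    (Set.extremePoints ℝ (convexHull ℝ ((fun e : Fin 2 →₀ ℕ => fun i : Fin 2 => ((e i : ℕ) : ℝ)) ''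
      (((Finset.univ.filter fun J : Finset (Fin N) => ∑ j ∈ J, g j = v).image
        fun J => ∑ j ∈ J, d j : Finset (Fin 2 →₀ ℕ)) : Set (Fin 2 →₀ ℕ))))).ncard ≤
      (2 ^ r * N + 2) ^ b :=
  stub_signLevelSetOfT2All b (fun N r g v d hd => stub_signLevelSetOfT2 b hT2 N r g v d hd) N r g v d

/-- **T2 ⇒ exact-cover shadow bound.**  If the open stub holds with exponent `b`, then for every labelled family
`g : Fin N → (Fin r → ZMod 2)` and every `ε : Fin N → ℕ²`, the points `Σ_{j∈J} ε_j` of the EXACT COVERS `J` (every coordinate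
`i < r` covered by exactly one `j ∈ J`) that are strict minimisers of some `w₀ x₀ + w₁ x₁` with `w₀, w₁ > 0` number at most
`(2^r·N + 2)^b`.  Proof: odd covers of the all-ones target weigh `≥ r`, with equality exactly for exact covers
(`stub_oddCoverWeight`); penalise every item by `Cst·wt j·(1,1)` with `Cst > Σ_j (ε_j 0 + ε_j 1)` — strict positive minimisers of
the minimum-weight face stay strict minimisers of the penalised odd-cover cloud (`stub_penalisedFace`), which is the sign level set
of `d j := ε j + (Cst·wt j)•(1,1)` at `v = 1`, bounded by `signLevelSet_of_T2`.  Instances: set partitions of `[r]` (items = nonempty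
subsets), perfect matchings (items = pairs), axial 3-assignments (items = transversal triples). [folklore] -/
theorem exactCoverShadow_of_T2 (b : ℕ)
    (hT2 : ∀ (K N : ℕ) (c : Fin K → ℂ) (ρ : Fin K → Fin N → ℂ) (d : Fin N → (Fin 2 →₀ ℕ)),
      vert (∑ l, C (c l) * ∏ j, (1 - C (ρ l j) * monomial (d j) 1)) ≤ (K * N + 2) ^ b)
    (N r : ℕ) (g : Fin N → Fin r → ZMod 2) (ε : Fin N → (Fin 2 →₀ ℕ)) :
    {q : Fin 2 →₀ ℕ | ∃ J : Finset (Fin N), (∀ i : Fin r, (J.filter fun j => g j i = 1).card = 1) ∧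
        ∑ j ∈ J, ε j = q ∧ ∃ w : Fin 2 → ℝ, 0 < w 0 ∧ 0 < w 1 ∧
        ∀ J' : Finset (Fin N), (∀ i : Fin r, (J'.filter fun j => g j i = 1).card = 1) → ∑ j ∈ J', ε j ≠ q →
          w 0 * ((q 0 : ℕ) : ℝ) + w 1 * ((q 1 : ℕ) : ℝ) <
            w 0 * (((∑ j ∈ J', ε j) 0 : ℕ) : ℝ) + w 1 * (((∑ j ∈ J', ε j) 1 : ℕ) : ℝ)}.ncard ≤
      (2 ^ r * N + 2) ^ b := by
  classical
  -- the odd-cover family, its points, sizes and the penalty constant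
  set F : Finset (Finset (Fin N)) := Finset.univ.filter fun J : Finset (Fin N) => ∑ j ∈ J, g j = fun _ => 1
    with hF
  set wt : Fin N → ℕ := fun j => (Finset.univ.filter fun i : Fin r => g j i = 1).card with hwt
  set s : Finset (Fin N) → ℕ := fun J => ∑ j ∈ J, wt j with hs
  set Cst : ℕ := ∑ j, (ε j 0 + ε j 1) + 1 with hCst
  have hsF : ∀ T ∈ F, r ≤ s T := fun T hT =>
    (stub_oddCoverWeight N r g T).1 (Finset.mem_filter.mp hT).2
  have hCF : ∀ T ∈ F, (∑ j ∈ T, ε j) 0 + (∑ j ∈ T, ε j) 1 < Cst := by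
    intro T _
    rw [hCst, Finsupp.finsetSum_apply, Finsupp.finsetSum_apply, ← Finset.sum_add_distrib]
    exact Nat.lt_succ_of_le (Finset.sum_le_univ_sum_of_nonneg fun _ => Nat.zero_le _)
  have hexact : ∀ J : Finset (Fin N),
      (∀ i : Fin r, (J.filter fun j => g j i = 1).card = 1) ↔ (J ∈ F ∧ s J = r) := by
    intro J
    rw [← (stub_oddCoverWeight N r g J).2, hF, Finset.mem_filter]
    simp only [Finset.mem_univ, true_and, hs, hwt]
  -- Step 1 (P4): the exposed exact-cover points are the exposed minimum-size points of `F`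
  have step1 : {q : Fin 2 →₀ ℕ | ∃ J : Finset (Fin N), (∀ i : Fin r, (J.filter fun j => g j i = 1).card = 1) ∧
        ∑ j ∈ J, ε j = q ∧ ∃ w : Fin 2 → ℝ, 0 < w 0 ∧ 0 < w 1 ∧
        ∀ J' : Finset (Fin N), (∀ i : Fin r, (J'.filter fun j => g j i = 1).card = 1) → ∑ j ∈ J', ε j ≠ q →
          w 0 * ((q 0 : ℕ) : ℝ) + w 1 * ((q 1 : ℕ) : ℝ) <
            w 0 * (((∑ j ∈ J', ε j) 0 : ℕ) : ℝ) + w 1 * (((∑ j ∈ J', ε j) 1 : ℕ) : ℝ)} =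
      {q : Fin 2 →₀ ℕ | ∃ T ∈ F, s T = r ∧ (∑ j ∈ T, ε j) = q ∧ ∃ w : Fin 2 → ℝ, 0 < w 0 ∧ 0 < w 1 ∧
        ∀ T' ∈ F, s T' = r → (∑ j ∈ T', ε j) ≠ q →
          w 0 * ((q 0 : ℕ) : ℝ) + w 1 * ((q 1 : ℕ) : ℝ) <
            w 0 * (((∑ j ∈ T', ε j) 0 : ℕ) : ℝ) + w 1 * (((∑ j ∈ T', ε j) 1 : ℕ) : ℝ)} := by
    ext q
    simp only [Set.mem_setOf_eq]
    constructor
    · rintro ⟨J, hJ, hq, w, hw0, hw1, hmin⟩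
      exact ⟨J, ((hexact J).1 hJ).1, ((hexact J).1 hJ).2, hq, w, hw0, hw1,
        fun T' hT' hsT' hne => hmin T' ((hexact T').2 ⟨hT', hsT'⟩) hne⟩
    · rintro ⟨T, hT, hsT, hq, w, hw0, hw1, hmin⟩
      exact ⟨T, (hexact T).2 ⟨hT, hsT⟩, hq, w, hw0, hw1,
        fun J' hJ' hne => hmin J' ((hexact J').1 hJ').1 ((hexact J').1 hJ').2 hne⟩
  rw [step1]
  -- Step 2 (P3): penalise by `Cst · size`
  refine (stub_penalisedFace F (fun T => ∑ j ∈ T, ε j) s r Cst hsF hCF).trans ?_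
  -- Step 3 (P1 + P2): the penalised cloud is the sign level set of `d j := ε j + (Cst * wt j) • (1,1)`
  have hpen : (F.image fun T => ∑ j ∈ T, ε j + (Cst * s T) • (Finsupp.single 0 1 + Finsupp.single 1 1)) =
      ((Finset.univ.filter fun J : Finset (Fin N) => ∑ j ∈ J, g j = fun _ => 1).image
        fun J => ∑ j ∈ J, (ε j + (Cst * wt j) • (Finsupp.single 0 1 + Finsupp.single 1 1) : Fin 2 →₀ ℕ)) := by
    rw [hF]
    refine Finset.image_congr fun T _ => ?_
    rw [Finset.sum_add_distrib, hs]
    simp only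
    rw [Finset.mul_sum, Finset.sum_smul]
  rw [hpen]
  exact signLevelSet_of_T2 b hT2 N r g (fun _ => 1) _

end Summit.ValiantsHypothesis.ValiantsHypothesis.Theorems.NewtonUnitEquationsNewtonTauWeak

end
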